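import Summits.QuantumFields.YangMills.Theorems.AllWindowsColdBoxBoxHighLineEdgeChartMoments
import Summits.QuantumFields.YangMills.Theorems.WeakCouplingRatesBulkDominatesColdBoxWDlrPlumbing

/-!
# T-S5.12a `CubicVariance` from T-S5.7a `WilsonPlaquetteTaylor` — `E₀[V₃²] ≤ C·H⁴(1+log H)³/β` for `β ≥ H⁴`, `H ≥ 1`

Planner ym-idea-2 g18's `TaskS5Step2Wick.lean` (✓`…Step2Wick`): `cubicVertex β H a = β · Σ_{p touching the box} c_p^{odd}(a)`.  Given 7a (the cubic Taylor
term of the plaquette cost is a triple product, `|c^{odd} − tripleForm T v| ≤ C t⁵` when all `‖v_i‖ ≤ t ≤ 1`), the remainder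
`R_p = c_p^{odd} − tripleForm T_p (plaqVar_p)` obeys `|R_p| ≤ (4 + 6C)·(Σ_i ‖v_i‖)⁵` UNIFORMLY (off the unit ball `|c^{odd}| ≤ 4` by ✓`abs_plaqCostAt_le` and
`|tripleForm| ≤ 6C(Σ‖v_i‖)³`), so

  `V₃² ≤ 2(β Σ_p tripleForm)² + 2β²·#P·(4+6C)²·4⁹·Σ_p Σ_i Σ_{e free} [e = edge_i(p)]·‖a_e‖¹⁰`

pointwise; the first term is ✓`tripleBond_gaussAvg_le` (`≤ C'·C²·H⁴(1+log H)³/β`), the second is `≲ #P²·β²·β⁻⁵ ≲ H⁸/β³ ≤ H⁴/β` by the tenth moments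
✓`gaussAvg_norm_pow_ten_le` and `β ≥ H⁴ ≥ 1`.  Main result: ★★`cubicVariance_of : WilsonPlaquetteTaylor → CubicVariance` (with `m = 3`).

Tree (✓EdgeChartMoments chain, ✓Step2Wick, ✓`abs_plaqCostAt_le`) + Mathlib; no definitions.  HONEST LABEL: 12a modulo 7a (w2's brick, OPEN); T-S5.10, T-S5.13/S5, U5,
⟨24004⟩ ⟨24335⟩ ⟨24336⟩ remain OPEN; route AllWindowsColdBox is DRAFT; no rung is proved; the Yang–Mills mass gap is NOT proved by this file.
Seat ym-line-sfw-p2 g77 (LEAD, cell ym-idea-1; Wick layer T-S5.10/11/12a).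
-/

set_option autoImplicit false

noncomputable section

open MeasureTheory Matrix Finset
open scoped Kronecker Nat Matrix
open Literature.Probability.LatticeModels (Site)
open Literature.MathematicalPhysics.QuantumLattice (ZdPlaquette plaquettesTouching)

namespace Summit.QuantumFields.YangMills.Theorems.AllWindowsColdBoxBoxHighLine

namespace EdgeChartGaussian

/-! ## §1 Pointwise bounds on the vertex pieces -/

/-- `|u·(v × w)| ≤ 6‖u‖‖v‖‖w‖`. -/
theorem abs_triple_product_le (u v w : E3) :
    |WithLp.ofLp u ⬝ᵥ (WithLp.ofLp v ⨯₃ WithLp.ofLp w)| ≤ 6 * (‖u‖ * ‖v‖ * ‖w‖) := by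
  obtain ⟨col, sg, -, hsg, hexp⟩ := triple_product_expansion
  -- `|x_c| ≤ ‖x‖` on `ℝ³` (Mathlib `PiLp.norm_apply_le`; tree: `abs_apply_le_norm_E3`)
  have abs_apply_le_norm : ∀ (x : E3) (c : Fin 3), |x c| ≤ ‖x‖ := fun x c => by
    have h := PiLp.norm_apply_le x c
    rwa [Real.norm_eq_abs] at h
  rw [hexp]
  refine (Finset.abs_sum_le_sum_abs _ _).trans ?_
  have hterm : ∀ t : Fin 6, |sg t * (WithLp.ofLp u (col t 0) * WithLp.ofLp v (col t 1) * WithLp.ofLp w (col t 2))| ≤ ‖u‖ * ‖v‖ * ‖w‖ := by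
    intro t
    rw [abs_mul, hsg, one_mul, abs_mul, abs_mul]
    exact mul_le_mul (mul_le_mul (abs_apply_le_norm u _) (abs_apply_le_norm v _) (abs_nonneg _) (norm_nonneg _))
      (abs_apply_le_norm w _) (abs_nonneg _) (mul_nonneg (norm_nonneg _) (norm_nonneg _))
  calc ∑ t : Fin 6, |sg t * (WithLp.ofLp u (col t 0) * WithLp.ofLp v (col t 1) * WithLp.ofLp w (col t 2))|
      ≤ ∑ _t : Fin 6, ‖u‖ * ‖v‖ * ‖w‖ := Finset.sum_le_sum fun t _ => hterm t
    _ = 6 * (‖u‖ * ‖v‖ * ‖w‖) := by rw [Finset.sum_const, Finset.card_univ, Fintype.card_fin, nsmul_eq_mul]; norm_num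

/-- `|tripleForm T v| ≤ 6B·(Σ_i ‖v_i‖)³` for `|T| ≤ B`. -/
theorem abs_tripleForm_le (T : Fin 4 → Fin 4 → Fin 4 → ℝ) {B : ℝ} (hT : ∀ i j k, |T i j k| ≤ B) (v : Fin 4 → E3) :
    |tripleForm T v| ≤ 6 * B * (∑ i : Fin 4, ‖v i‖) ^ 3 := by
  have hB : 0 ≤ B := (abs_nonneg _).trans (hT 0 0 0)
  unfold tripleForm
  have hterm : ∀ i j k : Fin 4, |T i j k * (WithLp.ofLp (v i) ⬝ᵥ (WithLp.ofLp (v j) ⨯₃ WithLp.ofLp (v k)))| ≤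
      6 * B * (‖v i‖ * ‖v j‖ * ‖v k‖) := by
    intro i j k
    rw [abs_mul]
    calc |T i j k| * |WithLp.ofLp (v i) ⬝ᵥ (WithLp.ofLp (v j) ⨯₃ WithLp.ofLp (v k))| ≤ B * (6 * (‖v i‖ * ‖v j‖ * ‖v k‖)) :=
          mul_le_mul (hT i j k) (abs_triple_product_le _ _ _) (abs_nonneg _) hB
      _ = 6 * B * (‖v i‖ * ‖v j‖ * ‖v k‖) := by ring
  have hcube : (∑ i : Fin 4, ‖v i‖) ^ 3 = ∑ i : Fin 4, ∑ j : Fin 4, ∑ k : Fin 4, ‖v i‖ * ‖v j‖ * ‖v k‖ := by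
    rw [pow_succ, pow_two, Finset.sum_mul_sum, Finset.sum_mul]
    refine Finset.sum_congr rfl fun i _ => ?_
    rw [Finset.sum_mul]
    refine Finset.sum_congr rfl fun j _ => ?_
    rw [Finset.mul_sum]
  rw [hcube, Finset.mul_sum]
  refine (Finset.abs_sum_le_sum_abs _ _).trans (Finset.sum_le_sum fun i _ => ?_)
  rw [Finset.mul_sum]
  refine (Finset.abs_sum_le_sum_abs _ _).trans (Finset.sum_le_sum fun j _ => ?_)
  rw [Finset.mul_sum]
  exact (Finset.abs_sum_le_sum_abs _ _).trans (Finset.sum_le_sum fun k _ => hterm i j k)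

/-- `|c_p^{odd}| ≤ 4` (from `|plaqCostAt| ≤ 4` for `SU(2)`). -/
theorem abs_chartPlaqCostOdd_le (H : ℕ) (x : Site 4) (μ ν : Fin 4) (a : LandauFree H → E3) : |chartPlaqCostOdd H x μ ν a| ≤ 4 := by
  unfold chartPlaqCostOdd chartPlaqCost
  have h1 := Summit.QuantumFields.YangMills.Theorems.WeakCouplingRates.abs_plaqCostAt_le x μ ν (edgeChart H a)
  have h2 := Summit.QuantumFields.YangMills.Theorems.WeakCouplingRates.abs_plaqCostAt_le x μ ν (edgeChart H (-a))
  rw [abs_div, abs_two]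
  have h3 := abs_sub (Summit.QuantumFields.YangMills.Theorems.WeakCouplingRates.plaqCostAt (G := SU2) (Literature.MathematicalPhysics.QuantumLattice.fundamentalRep (Fin 2)) x μ ν (edgeChart H a))
    (Summit.QuantumFields.YangMills.Theorems.WeakCouplingRates.plaqCostAt (G := SU2) (Literature.MathematicalPhysics.QuantumLattice.fundamentalRep (Fin 2)) x μ ν (edgeChart H (-a)))
  linarith

/-- ★ **Uniform quintic bound on the Taylor remainder of the odd plaquette cost**: if `|T| ≤ C` and 7a's estimate
`|c^{odd} − tripleForm T v| ≤ C t⁵` holds for all `‖v_i‖ ≤ t ≤ 1`, then for EVERY field `|c^{odd} − tripleForm T v| ≤ (4 + 6C)·(Σ_i ‖v_i‖)⁵`. -/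
theorem abs_odd_sub_tripleForm_le {C : ℝ} {T : Fin 4 → Fin 4 → Fin 4 → ℝ} (hT : ∀ i j k, |T i j k| ≤ C) (H : ℕ) (x : Site 4) (μ ν : Fin 4)
    (h7 : ∀ (t : ℝ) (a : LandauFree H → E3), 0 ≤ t → t ≤ 1 → (∀ i, ‖plaqVar H x μ ν a i‖ ≤ t) →
      |chartPlaqCostOdd H x μ ν a - tripleForm T (plaqVar H x μ ν a)| ≤ C * t ^ 5)
    (a : LandauFree H → E3) :
    |chartPlaqCostOdd H x μ ν a - tripleForm T (plaqVar H x μ ν a)| ≤ (4 + 6 * C) * (∑ i : Fin 4, ‖plaqVar H x μ ν a i‖) ^ 5 := by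
  have hC : 0 ≤ C := (abs_nonneg _).trans (hT 0 0 0)
  set s := ∑ i : Fin 4, ‖plaqVar H x μ ν a i‖ with hs
  have hs0 : 0 ≤ s := Finset.sum_nonneg fun i _ => norm_nonneg _
  have hle : ∀ i, ‖plaqVar H x μ ν a i‖ ≤ s := fun i =>
    Finset.single_le_sum (f := fun i => ‖plaqVar H x μ ν a i‖) (fun j _ => norm_nonneg _) (Finset.mem_univ i)
  by_cases h1 : s ≤ 1
  · refine (h7 s a hs0 h1 hle).trans ?_
    have : 0 ≤ s ^ 5 := pow_nonneg hs0 5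
    nlinarith
  · have hs1 : 1 ≤ s := le_of_lt (not_le.1 h1)
    have hs5 : 1 ≤ s ^ 5 := one_le_pow₀ hs1
    have hs35 : s ^ 3 ≤ s ^ 5 := pow_le_pow_right₀ hs1 (by norm_num)
    calc |chartPlaqCostOdd H x μ ν a - tripleForm T (plaqVar H x μ ν a)|
        ≤ |chartPlaqCostOdd H x μ ν a| + |tripleForm T (plaqVar H x μ ν a)| := abs_sub _ _
      _ ≤ 4 + 6 * C * s ^ 3 := add_le_add (abs_chartPlaqCostOdd_le H x μ ν a) (abs_tripleForm_le T hT _)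
      _ ≤ 4 * s ^ 5 + 6 * C * s ^ 5 := add_le_add (by linarith) (mul_le_mul_of_nonneg_left hs35 (by positivity))
      _ = (4 + 6 * C) * s ^ 5 := by ring

/-- A plaquette variable's norm power is dominated by the free-edge sum: `‖v_i‖¹⁰ ≤ Σ_{e free} [e = edge_i]·‖a_e‖¹⁰`. -/
theorem norm_plaqVar_pow_le_sum (H : ℕ) (x : Site 4) (μ ν i : Fin 4) (a : LandauFree H → E3) :
    ‖plaqVar H x μ ν a i‖ ^ 10 ≤ ∑ e : LandauFree H,
      if (e.1.1 : Literature.MathematicalPhysics.QuantumLattice.ZdEdge 4) = plaqEdge x μ ν i then ‖a e‖ ^ 10 else 0 := by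
  classical
  unfold plaqVar freeVec
  split_ifs with h h'
  · refine (Finset.single_le_sum (f := fun e : LandauFree H =>
      if (e.1.1 : Literature.MathematicalPhysics.QuantumLattice.ZdEdge 4) = plaqEdge x μ ν i then ‖a e‖ ^ 10 else 0)
      (fun e _ => ?_) (Finset.mem_univ (⟨⟨plaqEdge x μ ν i, h⟩, not_not_intro h'⟩ : LandauFree H))).trans' ?_
    · split_ifs <;> positivity
    · simp
  · rw [norm_zero, zero_pow (by norm_num)]
    exact Finset.sum_nonneg fun e _ => by split_ifs <;> positivity
  · rw [norm_zero, zero_pow (by norm_num)]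
    exact Finset.sum_nonneg fun e _ => by split_ifs <;> positivity

/-- At most one free edge sits on a given lattice edge: `Σ_e [e = ed]·g ≤ g` for a constant `g ≥ 0`. -/
theorem sum_indicator_edge_le (H : ℕ) (ed : Literature.MathematicalPhysics.QuantumLattice.ZdEdge 4) {g : ℝ} (hg : 0 ≤ g) :
    (∑ e : LandauFree H, if (e.1.1 : Literature.MathematicalPhysics.QuantumLattice.ZdEdge 4) = ed then g else 0) ≤ g := by
  classical
  rw [← Finset.sum_filter, Finset.sum_const, nsmul_eq_mul]
  have hcard : (Finset.univ.filter fun e : LandauFree H => (e.1.1 : Literature.MathematicalPhysics.QuantumLattice.ZdEdge 4) = ed).card ≤ 1 := by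
    refine Finset.card_le_one.2 fun e he e' he' => ?_
    rw [Finset.mem_filter] at he he'
    exact landauFree_ext (he.2.trans he'.2.symm)
  calc ((Finset.univ.filter fun e : LandauFree H => (e.1.1 : Literature.MathematicalPhysics.QuantumLattice.ZdEdge 4) = ed).card : ℝ) * g
      ≤ 1 * g := mul_le_mul_of_nonneg_right (by exact_mod_cast hcard) hg
    _ = g := one_mul g

/-! ## §2 12a from 7a -/

/-- ★★ **T-S5.12a from T-S5.7a**: `WilsonPlaquetteTaylor → CubicVariance` (with `m = 3`). -/
theorem cubicVariance_of (h7a : WilsonPlaquetteTaylor) : CubicVariance := by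
  classical
  obtain ⟨C7, h7⟩ := h7a
  -- choose the triple-product coefficients plane by plane
  choose Tf hTf h7f using h7
  let T : ZdPlaquette 4 → Fin 4 → Fin 4 → Fin 4 → ℝ := fun p => Tf p.2.1.1 p.2.1.2 (ne_of_lt p.2.2)
  have hT : ∀ p i j k, |T p i j k| ≤ C7 := fun p => hTf _ _ _
  have hC7 : 0 ≤ C7 := (abs_nonneg _).trans (hT (((0 : Site 4), ⟨(0, 1), by decide⟩) : ZdPlaquette 4) 0 0 0)
  obtain ⟨CTB, hTB⟩ := tripleBond_gaussAvg_le
  obtain ⟨C10, hC10, h10⟩ := gaussAvg_norm_pow_ten_le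
  set C8 : ℝ := 4 + 6 * C7 with hC8
  refine ⟨2 * (CTB * C7 ^ 2) + 8 * 4 ^ 9 * 2 ^ 24 * C8 ^ 2 * C10, 3, fun H hH β hβH => ?_⟩
  set PT := plaquettesTouching (Literature.MathematicalPhysics.QuantumFieldTheory.AxialGauge.boxEdges 4 (2 * H + 1)) with hPT
  have hH1 : (1 : ℝ) ≤ H := by exact_mod_cast hH
  have hβ1 : 1 ≤ β := (one_le_pow₀ hH1 : (1 : ℝ) ≤ (H : ℝ) ^ 4).trans hβH
  have hβ : 0 < β := by linarith
  set L := 1 + Real.log H with hL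
  have hL1 : 1 ≤ L := by have := Real.log_nonneg hH1; rw [hL]; linarith
  -- the pieces
  let P : ZdPlaquette 4 → (LandauFree H → E3) → ℝ := fun p a => tripleForm (T p) (plaqVar H p.1 p.2.1.1 p.2.1.2 a)
  let R : ZdPlaquette 4 → (LandauFree H → E3) → ℝ := fun p a => chartPlaqCostOdd H p.1 p.2.1.1 p.2.1.2 a - P p a
  let D : ZdPlaquette 4 → Fin 4 → (LandauFree H → E3) → ℝ := fun p i a =>
    ∑ e : LandauFree H, if (e.1.1 : Literature.MathematicalPhysics.QuantumLattice.ZdEdge 4) = plaqEdge p.1 p.2.1.1 p.2.1.2 i then ‖a e‖ ^ 10 else 0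
  have hR : ∀ p a, |R p a| ≤ C8 * (∑ i : Fin 4, ‖plaqVar H p.1 p.2.1.1 p.2.1.2 a i‖) ^ 5 := fun p a =>
    abs_odd_sub_tripleForm_le (hTf _ _ _) H p.1 p.2.1.1 p.2.1.2 (fun t a ht ht1 hv => (h7f _ _ _ H p.1 t a ht ht1 hv).2) a
  have hR2 : ∀ p a, R p a ^ 2 ≤ C8 ^ 2 * 4 ^ 9 * ∑ i : Fin 4, D p i a := by
    intro p a
    have h1 := hR p a
    have hs0 : 0 ≤ ∑ i : Fin 4, ‖plaqVar H p.1 p.2.1.1 p.2.1.2 a i‖ := Finset.sum_nonneg fun i _ => norm_nonneg _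
    have hj := pow_sum_le_card_mul_sum_pow (s := (Finset.univ : Finset (Fin 4))) (f := fun i => ‖plaqVar H p.1 p.2.1.1 p.2.1.2 a i‖)
      (fun i _ => norm_nonneg _) 9
    simp only [Finset.card_univ, Fintype.card_fin] at hj
    have hD : ∑ i : Fin 4, ‖plaqVar H p.1 p.2.1.1 p.2.1.2 a i‖ ^ 10 ≤ ∑ i : Fin 4, D p i a :=
      Finset.sum_le_sum fun i _ => norm_plaqVar_pow_le_sum H p.1 p.2.1.1 p.2.1.2 i a
    have habs : R p a ^ 2 = |R p a| ^ 2 := (sq_abs _).symm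
    have h5 : |R p a| ^ 2 ≤ (C8 * (∑ i : Fin 4, ‖plaqVar H p.1 p.2.1.1 p.2.1.2 a i‖) ^ 5) ^ 2 :=
      pow_le_pow_left₀ (abs_nonneg _) h1 2
    rw [habs]
    refine h5.trans ?_
    calc (C8 * (∑ i : Fin 4, ‖plaqVar H p.1 p.2.1.1 p.2.1.2 a i‖) ^ 5) ^ 2
        = C8 ^ 2 * (∑ i : Fin 4, ‖plaqVar H p.1 p.2.1.1 p.2.1.2 a i‖) ^ 10 := by ring
      _ ≤ C8 ^ 2 * ((4 : ℝ) ^ 9 * ∑ i : Fin 4, ‖plaqVar H p.1 p.2.1.1 p.2.1.2 a i‖ ^ 10) := by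
          refine mul_le_mul_of_nonneg_left ?_ (sq_nonneg _)
          exact_mod_cast hj
      _ ≤ C8 ^ 2 * ((4 : ℝ) ^ 9 * ∑ i : Fin 4, D p i a) := by
          refine mul_le_mul_of_nonneg_left (mul_le_mul_of_nonneg_left hD (by norm_num)) (sq_nonneg _)
      _ = C8 ^ 2 * 4 ^ 9 * ∑ i : Fin 4, D p i a := by ring
  -- pointwise domination of V₃²
  have hdom : ∀ a : LandauFree H → E3, cubicVertex β H a ^ 2 ≤
      2 * (β * ∑ p ∈ PT, P p a) ^ 2 + 2 * β ^ 2 * PT.card * (C8 ^ 2 * 4 ^ 9) * ∑ p ∈ PT, ∑ i : Fin 4, D p i a := by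
    intro a
    have hV : cubicVertex β H a = β * ∑ p ∈ PT, P p a + β * ∑ p ∈ PT, R p a := by
      unfold cubicVertex
      rw [← mul_add, ← Finset.sum_add_distrib]
      congr 1
      exact Finset.sum_congr rfl fun p _ => by simp only [R, P]; ring
    rw [hV]
    have hsq : (β * ∑ p ∈ PT, P p a + β * ∑ p ∈ PT, R p a) ^ 2 ≤ 2 * (β * ∑ p ∈ PT, P p a) ^ 2 + 2 * (β * ∑ p ∈ PT, R p a) ^ 2 := by
      nlinarith [sq_nonneg (β * ∑ p ∈ PT, P p a - β * ∑ p ∈ PT, R p a)]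
    refine hsq.trans (add_le_add le_rfl ?_)
    have hcs : (∑ p ∈ PT, R p a) ^ 2 ≤ PT.card * ∑ p ∈ PT, R p a ^ 2 := sq_sum_le_card_mul_sum_sq
    have hsumR : ∑ p ∈ PT, R p a ^ 2 ≤ ∑ p ∈ PT, C8 ^ 2 * 4 ^ 9 * ∑ i : Fin 4, D p i a := Finset.sum_le_sum fun p _ => hR2 p a
    rw [← Finset.mul_sum] at hsumR
    calc 2 * (β * ∑ p ∈ PT, R p a) ^ 2 = 2 * β ^ 2 * (∑ p ∈ PT, R p a) ^ 2 := by ring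
      _ ≤ 2 * β ^ 2 * (PT.card * ∑ p ∈ PT, R p a ^ 2) := mul_le_mul_of_nonneg_left hcs (by positivity)
      _ ≤ 2 * β ^ 2 * (PT.card * (C8 ^ 2 * 4 ^ 9 * ∑ p ∈ PT, ∑ i : Fin 4, D p i a)) :=
          mul_le_mul_of_nonneg_left (mul_le_mul_of_nonneg_left hsumR (Nat.cast_nonneg _)) (by positivity)
      _ = _ := by ring
  -- integrability of the majorant
  have hPint : Integrable (fun a : LandauFree H → E3 => (β * ∑ p ∈ PT, P p a) ^ 2 * gaussWeight β H a) := by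
    have hfun : (fun a : LandauFree H → E3 => (β * ∑ p ∈ PT, P p a) ^ 2 * gaussWeight β H a) =
        fun a => ∑ p ∈ PT, ∑ p' ∈ PT, β ^ 2 * (P p a * P p' a *
          Real.exp (-(β * ∑ c : Fin 3, (fun e => a e c) ⬝ᵥ (hodgeQ H *ᵥ fun e => a e c)))) := by
      funext a
      rw [gaussWeight_eq, mul_pow, pow_two (∑ p ∈ PT, P p a), Finset.sum_mul_sum, mul_assoc, Finset.sum_mul, Finset.mul_sum]
      refine Finset.sum_congr rfl fun p _ => ?_
      rw [Finset.sum_mul, Finset.mul_sum]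
    rw [hfun]
    exact integrable_finsetSum _ fun p _ => integrable_finsetSum _ fun p' _ =>
      (integrable_tripleForm_mul_tripleForm H hβ _ _ _ _ _ _ (T p) (T p') (hT p) (hT p')).const_mul _
  have hDint : ∀ p i, Integrable (fun a : LandauFree H → E3 => D p i a * gaussWeight β H a) := by
    intro p i
    have hfun : (fun a : LandauFree H → E3 => D p i a * gaussWeight β H a) = fun a => ∑ e : LandauFree H,
        (if (e.1.1 : Literature.MathematicalPhysics.QuantumLattice.ZdEdge 4) = plaqEdge p.1 p.2.1.1 p.2.1.2 i then (1 : ℝ) else 0) *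
          (‖a e‖ ^ 10 * gaussWeight β H a) := by
      funext a
      simp only [D, Finset.sum_mul]
      refine Finset.sum_congr rfl fun e _ => ?_
      split_ifs <;> ring
    rw [hfun]
    exact integrable_finsetSum _ fun e _ => (integrable_norm_pow_ten_mul_gaussWeight H hβ e).const_mul _
  have hGint : Integrable (fun a : LandauFree H → E3 =>
      (2 * (β * ∑ p ∈ PT, P p a) ^ 2 + 2 * β ^ 2 * PT.card * (C8 ^ 2 * 4 ^ 9) * ∑ p ∈ PT, ∑ i : Fin 4, D p i a) * gaussWeight β H a) := by
    have h2 : Integrable (fun a : LandauFree H → E3 => (∑ p ∈ PT, ∑ i : Fin 4, D p i a) * gaussWeight β H a) := by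
      have hfun : (fun a : LandauFree H → E3 => (∑ p ∈ PT, ∑ i : Fin 4, D p i a) * gaussWeight β H a) =
          fun a => ∑ p ∈ PT, ∑ i : Fin 4, D p i a * gaussWeight β H a := by
        funext a; rw [Finset.sum_mul]; exact Finset.sum_congr rfl fun p _ => Finset.sum_mul _ _ _
      rw [hfun]
      exact integrable_finsetSum _ fun p _ => integrable_finsetSum _ fun i _ => hDint p i
    have h := (hPint.const_mul 2).add (h2.const_mul (2 * β ^ 2 * PT.card * (C8 ^ 2 * 4 ^ 9)))
    refine h.congr (Filter.Eventually.of_forall fun a => ?_)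
    simp only [Pi.add_apply]
    ring
  -- the Gaussian averages of the two pieces
  have hE1 : gaussAvg β H (fun a => (β * ∑ p ∈ PT, P p a) ^ 2) ≤ CTB * C7 ^ 2 * (H : ℝ) ^ 4 * L ^ 3 / β := hTB H hH β hβ C7 T hT
  have hE2 : gaussAvg β H (fun a => ∑ p ∈ PT, ∑ i : Fin 4, D p i a) ≤ 4 * PT.card * (C10 / β ^ 5) := by
    rw [gaussAvg_finset_sum _ _ _ _ fun p _ => ?_]
    · have hp : ∀ p ∈ PT, gaussAvg β H (fun a => ∑ i : Fin 4, D p i a) ≤ 4 * (C10 / β ^ 5) := by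
        intro p _
        rw [gaussAvg_finset_sum _ _ _ _ fun i _ => hDint p i]
        have hi : ∀ i : Fin 4, gaussAvg β H (D p i) ≤ C10 / β ^ 5 := by
          intro i
          have hDi : gaussAvg β H (D p i) = ∑ e : LandauFree H,
              if (e.1.1 : Literature.MathematicalPhysics.QuantumLattice.ZdEdge 4) = plaqEdge p.1 p.2.1.1 p.2.1.2 i then
                gaussAvg β H (fun a => ‖a e‖ ^ 10) else 0 := by
            have hfun : D p i = fun a => ∑ e : LandauFree H,
                (if (e.1.1 : Literature.MathematicalPhysics.QuantumLattice.ZdEdge 4) = plaqEdge p.1 p.2.1.1 p.2.1.2 i then (1 : ℝ) else 0) *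
                  ‖a e‖ ^ 10 := by
              funext a; simp only [D]; exact Finset.sum_congr rfl fun e _ => by split_ifs <;> simp
            rw [hfun, gaussAvg_finset_sum _ _ _ _ fun e _ => ?_]
            · refine Finset.sum_congr rfl fun e _ => ?_
              rw [gaussAvg_const_mul]; split_ifs <;> simp
            · have := (integrable_norm_pow_ten_mul_gaussWeight H hβ e).const_mul
                (if (e.1.1 : Literature.MathematicalPhysics.QuantumLattice.ZdEdge 4) = plaqEdge p.1 p.2.1.1 p.2.1.2 i then (1 : ℝ) else 0)
              refine this.congr (Filter.Eventually.of_forall fun a => ?_)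
              simp only; ring
          rw [hDi]
          refine (Finset.sum_le_sum fun e _ => ?_).trans (sum_indicator_edge_le H (plaqEdge p.1 p.2.1.1 p.2.1.2 i) (g := C10 / β ^ 5) (by positivity))
          split_ifs
          · exact h10 H hH β hβ e
          · exact le_refl _
        calc ∑ i : Fin 4, gaussAvg β H (D p i) ≤ ∑ _i : Fin 4, C10 / β ^ 5 := Finset.sum_le_sum fun i _ => hi i
          _ = 4 * (C10 / β ^ 5) := by rw [Finset.sum_const, Finset.card_univ, Fintype.card_fin, nsmul_eq_mul]; norm_num
      calc ∑ p ∈ PT, gaussAvg β H (fun a => ∑ i : Fin 4, D p i a) ≤ ∑ _p ∈ PT, 4 * (C10 / β ^ 5) := Finset.sum_le_sum hp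
        _ = 4 * PT.card * (C10 / β ^ 5) := by rw [Finset.sum_const, nsmul_eq_mul]; ring
    · have hfun : (fun a : LandauFree H → E3 => (∑ i : Fin 4, D p i a) * gaussWeight β H a) = fun a => ∑ i : Fin 4, D p i a * gaussWeight β H a := by
        funext a; exact Finset.sum_mul _ _ _
      rw [hfun]
      exact integrable_finsetSum _ fun i _ => hDint p i
  -- counting and the `β ≥ H⁴` bookkeeping
  have hcard := card_plaquettesTouching_le H
  have hH4 : (2 * (H : ℝ) + 2) ^ 4 ≤ 256 * (H : ℝ) ^ 4 := by
    have h1 : (2 * (H : ℝ) + 2) ≤ 4 * H := by linarith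
    calc (2 * (H : ℝ) + 2) ^ 4 ≤ (4 * (H : ℝ)) ^ 4 := pow_le_pow_left₀ (by positivity) h1 4
      _ = 256 * (H : ℝ) ^ 4 := by ring
  have hPTle : (PT.card : ℝ) ≤ 4096 * (H : ℝ) ^ 4 := hcard.trans (by linarith)
  have hH4β : (H : ℝ) ^ 4 ≤ β ^ 2 := hβH.trans (by nlinarith)
  -- assemble
  have hmain : gaussAvg β H (fun a => cubicVertex β H a ^ 2) ≤
      2 * (CTB * C7 ^ 2 * (H : ℝ) ^ 4 * L ^ 3 / β) + 2 * β ^ 2 * PT.card * (C8 ^ 2 * 4 ^ 9) * (4 * PT.card * (C10 / β ^ 5)) := by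
    calc gaussAvg β H (fun a => cubicVertex β H a ^ 2)
        ≤ gaussAvg β H (fun a => 2 * (β * ∑ p ∈ PT, P p a) ^ 2 + 2 * β ^ 2 * PT.card * (C8 ^ 2 * 4 ^ 9) * ∑ p ∈ PT, ∑ i : Fin 4, D p i a) :=
          gaussAvg_mono_of_nonneg H hβ (fun a => sq_nonneg _) hdom hGint
      _ = 2 * gaussAvg β H (fun a => (β * ∑ p ∈ PT, P p a) ^ 2) +
            2 * β ^ 2 * PT.card * (C8 ^ 2 * 4 ^ 9) * gaussAvg β H (fun a => ∑ p ∈ PT, ∑ i : Fin 4, D p i a) := by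
          have hPint2 : Integrable (fun a : LandauFree H → E3 => 2 * (β * ∑ p ∈ PT, P p a) ^ 2 * gaussWeight β H a) :=
            (hPint.const_mul 2).congr (Filter.Eventually.of_forall fun a => by ring)
          rw [gaussAvg_add _ _ hPint2, gaussAvg_const_mul, gaussAvg_const_mul]
          have h2 : Integrable (fun a : LandauFree H → E3 => (∑ p ∈ PT, ∑ i : Fin 4, D p i a) * gaussWeight β H a) := by
            have hfun : (fun a : LandauFree H → E3 => (∑ p ∈ PT, ∑ i : Fin 4, D p i a) * gaussWeight β H a) =
                fun a => ∑ p ∈ PT, ∑ i : Fin 4, D p i a * gaussWeight β H a := by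
              funext a; rw [Finset.sum_mul]; exact Finset.sum_congr rfl fun p _ => Finset.sum_mul _ _ _
            rw [hfun]
            exact integrable_finsetSum _ fun p _ => integrable_finsetSum _ fun i _ => hDint p i
          exact (h2.const_mul (2 * β ^ 2 * PT.card * (C8 ^ 2 * 4 ^ 9))).congr (Filter.Eventually.of_forall fun a => by ring)
      _ ≤ _ := add_le_add (mul_le_mul_of_nonneg_left hE1 (by norm_num)) (mul_le_mul_of_nonneg_left hE2 (by positivity))
  refine hmain.trans ?_
  -- second term: `8·4⁹·C8²·C10·#PT²/β³ ≤ 8·4⁹·2²⁴·C8²·C10·H⁴·L³/β`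
  have hβ0 : β ≠ 0 := hβ.ne'
  have hβinv : β ^ 2 / β ^ 5 = 1 / β ^ 3 := by
    rw [div_eq_div_iff (pow_ne_zero 5 hβ0) (pow_ne_zero 3 hβ0)]; ring
  have hT2 : 2 * β ^ 2 * PT.card * (C8 ^ 2 * 4 ^ 9) * (4 * PT.card * (C10 / β ^ 5)) =
      8 * 4 ^ 9 * C8 ^ 2 * C10 * (PT.card : ℝ) ^ 2 / β ^ 3 := by
    calc 2 * β ^ 2 * PT.card * (C8 ^ 2 * 4 ^ 9) * (4 * PT.card * (C10 / β ^ 5))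
        = 8 * 4 ^ 9 * C8 ^ 2 * C10 * (PT.card : ℝ) ^ 2 * (β ^ 2 / β ^ 5) := by ring
      _ = 8 * 4 ^ 9 * C8 ^ 2 * C10 * (PT.card : ℝ) ^ 2 / β ^ 3 := by rw [hβinv]; ring
  have hPT2 : (PT.card : ℝ) ^ 2 ≤ 2 ^ 24 * (H : ℝ) ^ 8 := by
    calc (PT.card : ℝ) ^ 2 ≤ (4096 * (H : ℝ) ^ 4) ^ 2 := pow_le_pow_left₀ (Nat.cast_nonneg _) hPTle 2
      _ = 2 ^ 24 * (H : ℝ) ^ 8 := by norm_num; ring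
  have hstep : (H : ℝ) ^ 8 / β ^ 3 ≤ (H : ℝ) ^ 4 * L ^ 3 / β := by
    -- `H⁸/β³ = (H⁴/β²)·(H⁴/β) ≤ H⁴/β ≤ H⁴L³/β`
    rw [div_le_div_iff₀ (by positivity) hβ]
    have hL3 : 1 ≤ L ^ 3 := one_le_pow₀ hL1
    have hH8 : 0 ≤ (H : ℝ) ^ 4 := by positivity
    calc (H : ℝ) ^ 8 * β = (H : ℝ) ^ 4 * β * (H : ℝ) ^ 4 := by ring
      _ ≤ (H : ℝ) ^ 4 * β * β ^ 2 := mul_le_mul_of_nonneg_left hH4β (by positivity)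
      _ = (H : ℝ) ^ 4 * 1 * β ^ 3 := by ring
      _ ≤ (H : ℝ) ^ 4 * L ^ 3 * β ^ 3 := by
          refine mul_le_mul_of_nonneg_right (mul_le_mul_of_nonneg_left hL3 hH8) (by positivity)
  rw [hT2]
  have hK : 0 ≤ 8 * 4 ^ 9 * C8 ^ 2 * C10 := by positivity
  calc 2 * (CTB * C7 ^ 2 * (H : ℝ) ^ 4 * L ^ 3 / β) + 8 * 4 ^ 9 * C8 ^ 2 * C10 * (PT.card : ℝ) ^ 2 / β ^ 3
      ≤ 2 * (CTB * C7 ^ 2 * (H : ℝ) ^ 4 * L ^ 3 / β) + 8 * 4 ^ 9 * C8 ^ 2 * C10 * (2 ^ 24 * (H : ℝ) ^ 8) / β ^ 3 := by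
        exact add_le_add le_rfl (div_le_div_of_nonneg_right (mul_le_mul_of_nonneg_left hPT2 hK) (by positivity))
    _ = 2 * (CTB * C7 ^ 2 * (H : ℝ) ^ 4 * L ^ 3 / β) + 8 * 4 ^ 9 * 2 ^ 24 * C8 ^ 2 * C10 * ((H : ℝ) ^ 8 / β ^ 3) := by ring
    _ ≤ 2 * (CTB * C7 ^ 2 * (H : ℝ) ^ 4 * L ^ 3 / β) + 8 * 4 ^ 9 * 2 ^ 24 * C8 ^ 2 * C10 * ((H : ℝ) ^ 4 * L ^ 3 / β) :=
        add_le_add le_rfl (mul_le_mul_of_nonneg_left hstep (by positivity))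
    _ = (2 * (CTB * C7 ^ 2) + 8 * 4 ^ 9 * 2 ^ 24 * C8 ^ 2 * C10) * (H : ℝ) ^ 4 * (1 + Real.log H) ^ 3 / β := by rw [hL]; ring

end EdgeChartGaussian

/-- ★★ **T-S5.12a by name, modulo T-S5.7a**: `WilsonPlaquetteTaylor → CubicVariance`. -/
theorem cubicVariance_of_wilsonPlaquetteTaylor (h7a : WilsonPlaquetteTaylor) : CubicVariance :=
  EdgeChartGaussian.cubicVariance_of h7a

end Summit.QuantumFields.YangMills.Theorems.AllWindowsColdBoxBoxHighLine

end
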